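import Summits.PneNP.PneNP.Theorems.SfmBlMachineGreedy
import Summits.PneNP.PneNP.Theorems.SfmBlMachineCaps
import Summits.PneNP.PneNP.Theorems.SfmBlMachineDictDecomp
import Summits.PneNP.PneNP.Theorems.SfmBlMachineDegree
import Summits.PneNP.PneNP.Theorems.SfmBlParamsFP

/-!
# Line «sfm-bl», MACHINE LAYER M5 (glue): leg lists ↔ the dictionary, cards, parameters and caps (stmt-PneNP-20523)

FRONTIER F-N1c; nothing here bears on P vs NP.

Bookkeeping for the closer, tying the spec of `SfmBlMachineGreedy` to prover-1's dictionary
(`SfmBlMachineDictPieces/Decomp`: `plegOf`, `LPiece/RPiece`, `srcM/dstM`, `pM`, `V₁M/V₂M`):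
* leg lists: `sublist_slegs` (`rlegs_sublist` is prover-1's, `SfmBlMachineCaps`), `nodup_slegs`, `plegOf_fst`, **`mem_rlegs_iff_pM`**,
  **`mem_slegs_iff_pM`** (the machine's remainder / spot leg lists are the records of `pM = none` / `pM = some s`);
* monotonicity under sublists: `length_nbrs_le_of_sublist`, `length_pieces_le_of_sublist`, and the fibre / walk /
  sequence count bounds `length_filter_lab_le`, `length_walksU_sub_le`, `length_aseqsU_sub_le`;
* cards: `card_V₁M_eq_length_lpieces` / `card_V₂M_eq_length_rpieces`, **`length_pieces_eq_card`** (the machine's `N` is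
  `|LPiece| + |RPiece|`);
* parameters for `N ≥ 1`: `params_bounds` (`2^(j+1) ≤ 40N`, `t₀ ≤ 40N`, `L^(2·2^(j+1)) ≤ (40N)^240`,
  `L^(2t₀) ≤ (40N)^120`, `2^t₀ ≤ 40N`, from p3's `sfmBl_params_bounds`), `prmT0'_eq`, `prmQ1'_eq` (clamps inactive).
-/

set_option linter.dupNamespace false -- `Summit.PneNP.PneNP.…`: summit = sub-problem name (D-0017 single-conjunct layout)

namespace Summit.PneNP.PneNP.Theorems.SfmBlMachine

open Finset Literature.Computability.Complexity
open Summit.PneNP.PneNP.Theorems.Nc03AvoidResidualCoreCandFewHeadsRungFP (trips)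

variable {n m : ℕ}

/-! ## Leg lists -/

/-- A label-selected leg list is a sublist of the pieced legs. -/
theorem sublist_filter_zip (plegs : List PLeg) (labels : List ℕ) (q : ℕ × PLeg → Bool) :
    List.Sublist (((labels.zip plegs).filter q).map Prod.snd) plegs :=
  ((List.filter_sublist).map Prod.snd).trans (map_snd_zip_sublist labels plegs)

/-- The legs of a spot are a sublist of the pieced legs. -/
theorem sublist_slegs (plegs : List PLeg) (labels : List ℕ) (s : ℕ) : List.Sublist (slegs plegs labels s) plegs :=
  sublist_filter_zip plegs labels _

/-- The legs of a spot have no duplicates. -/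
theorem nodup_slegs (L : ℕ) (trips : List (ℕ × ℕ × ℕ)) (labels : List ℕ) (s : ℕ) :
    (slegs (pieceLegs L trips) labels s).Nodup :=
  (nodup_pieceLegs L trips).sublist (sublist_slegs _ labels s)

/-- The record of a leg carries its output. -/
theorem plegOf_fst (L : ℕ) (I : LocalMap 3 n m) (e : Fin m × Fin 3) : (plegOf L I e).1 = e.1.val := by
  unfold plegOf pleg legIdx
  simp only
  have := e.2.isLt; omega

/-- The pieced leg at index `legIdx e` is the record of `e`. -/
theorem getElem_pieceLegs_legIdx (L : ℕ) (I : LocalMap 3 n m) (e : Fin m × Fin 3)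
    (h : legIdx e < (pieceLegs L (trips I)).length) : (pieceLegs L (trips I))[legIdx e] = plegOf L I e := by
  rw [pieceLegs_getElem]; rfl

/-- Membership in a label-selected leg list through the leg index. -/
theorem mem_filter_zip_iff (L : ℕ) (I : LocalMap 3 n m) {labels : List ℕ} (hlen : labels.length = 3 * m) (c : ℕ) (x : PLeg) :
    x ∈ (((labels.zip (pieceLegs L (trips I))).filter fun q => decide (q.1 = c)).map Prod.snd)
      ↔ ∃ e : Fin m × Fin 3, labOf labels e = c ∧ plegOf L I e = x := by
  have hlenP : (pieceLegs L (trips I)).length = 3 * m := by rw [length_pieceLegs, length_trips]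
  rw [List.mem_map]
  simp only [List.mem_filter, decide_eq_true_eq]
  constructor
  · rintro ⟨⟨lab, y⟩, ⟨hmem, hlab0⟩, rfl⟩
    simp only at hlab0 ⊢
    obtain ⟨i, hi, hq⟩ := List.mem_iff_getElem.1 hmem
    rw [List.length_zip, hlen, hlenP, min_self] at hi
    obtain ⟨e, rfl⟩ : ∃ e : Fin m × Fin 3, legIdx e = i :=
      ⟨(⟨i / 3, by omega⟩, ⟨i % 3, by omega⟩), by unfold legIdx; simp only; omega⟩
    rw [List.getElem_zip] at hq
    have h1 := congrArg Prod.fst hq; have h2 := congrArg Prod.snd hq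
    simp only at h1 h2
    refine ⟨e, ?_, ?_⟩
    · unfold labOf; rw [List.getD_eq_getElem _ _ (by rw [hlen]; exact legIdx_lt e), h1, hlab0]
    · rw [← h2, getElem_pieceLegs_legIdx]
  · rintro ⟨e, he, rfl⟩
    unfold labOf at he
    rw [List.getD_eq_getElem _ _ (by rw [hlen]; exact legIdx_lt e)] at he
    have hi : legIdx e < (labels.zip (pieceLegs L (trips I))).length := by
      rw [List.length_zip, hlen, hlenP, min_self]; exact legIdx_lt e
    refine ⟨(labels[legIdx e]'(by rw [hlen]; exact legIdx_lt e), plegOf L I e), ⟨?_, he⟩, rfl⟩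
    have := List.getElem_mem hi
    rwa [List.getElem_zip, getElem_pieceLegs_legIdx] at this

/-- **The remainder legs are the records of the legs with `pM = none`.** -/
theorem mem_rlegs_iff_pM (L : ℕ) (I : LocalMap 3 n m) {labels : List ℕ} {r : ℕ} (hlab : ∀ lab ∈ labels, lab ≤ r)
    (hlen : labels.length = 3 * m) (x : PLeg) :
    x ∈ rlegs (pieceLegs L (trips I)) labels ↔ ∃ e, pM labels r hlab e = none ∧ plegOf L I e = x := by
  unfold rlegs
  rw [mem_filter_zip_iff L I hlen 0 x]
  exact exists_congr fun e => by rw [pM_eq_none_iff]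

/-- **The legs of spot `s` are the records of the legs with `pM = some s`.** -/
theorem mem_slegs_iff_pM (L : ℕ) (I : LocalMap 3 n m) {labels : List ℕ} {r : ℕ} (hlab : ∀ lab ∈ labels, lab ≤ r)
    (hlen : labels.length = 3 * m) (s : Fin r) (x : PLeg) :
    x ∈ slegs (pieceLegs L (trips I)) labels s.val ↔ ∃ e, pM labels r hlab e = some s ∧ plegOf L I e = x := by
  unfold slegs
  rw [mem_filter_zip_iff L I hlen (s.val + 1) x]
  exact exists_congr fun e => by rw [pM_eq_some_iff]

/-- The same for the subtype of the legs of spot `s`. -/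
theorem mem_slegs_iff_subtype (L : ℕ) (I : LocalMap 3 n m) {labels : List ℕ} {r : ℕ} (hlab : ∀ lab ∈ labels, lab ≤ r)
    (hlen : labels.length = 3 * m) (s : Fin r) (x : PLeg) :
    x ∈ slegs (pieceLegs L (trips I)) labels s.val ↔ ∃ e : {e // pM labels r hlab e = some s}, plegOf L I e.1 = x := by
  rw [mem_slegs_iff_pM L I hlab hlen s x]
  exact ⟨fun ⟨e, he, hx⟩ => ⟨⟨e, he⟩, hx⟩, fun ⟨e, hx⟩ => ⟨e.1, e.2, hx⟩⟩

/-! ## Monotonicity under sublists; count bounds -/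

/-- Fewer legs, fewer neighbours. -/
theorem length_nbrs_le_of_sublist {es plegs : List PLeg} (h : List.Sublist es plegs) (P : Lab) :
    (nbrs es P).length ≤ (nbrs plegs P).length := by
  unfold nbrs
  rw [List.length_append, List.length_append, List.length_map, List.length_map, List.length_map, List.length_map]
  exact Nat.add_le_add (h.filter _).length_le (h.filter _).length_le

/-- Fewer legs, fewer pieces. -/
theorem length_pieces_le_of_sublist {es plegs : List PLeg} (h : List.Sublist es plegs) :
    (pieces es).length ≤ (pieces plegs).length := by
  classical
  unfold pieces
  rw [← List.card_toFinset, ← List.card_toFinset]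
  refine Finset.card_le_card fun P hP => ?_
  rw [List.mem_toFinset, List.mem_append, List.mem_map, List.mem_map] at hP ⊢
  rcases hP with ⟨x, hx, rfl⟩ | ⟨x, hx, rfl⟩
  · exact Or.inl ⟨x, h.subset hx, rfl⟩
  · exact Or.inr ⟨x, h.subset hx, rfl⟩

/-- Fibres of a sublist of the pieced legs have at most `L` legs (left and right). -/
theorem length_filter_lab_le {L : ℕ} (hL : 0 < L) (trips : List (ℕ × ℕ × ℕ)) {es : List PLeg}
    (h : List.Sublist es (pieceLegs L trips)) (P : Lab) :
    (es.filter fun y => labL y = P).length ≤ L ∧ (es.filter fun y => labR y = P).length ≤ L := by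
  have hn := length_nbrs_pieceLegs_le hL trips P
  unfold nbrs at hn
  rw [List.length_append, List.length_map, List.length_map] at hn
  exact ⟨(h.filter _).length_le.trans (by omega), (h.filter _).length_le.trans (by omega)⟩

/-- **Walk counts on a sublist of the pieced legs**: `≤ N · L^ℓ`. -/
theorem length_walksU_sub_le {L : ℕ} (hL : 0 < L) (trips : List (ℕ × ℕ × ℕ)) {es : List PLeg}
    (h : List.Sublist es (pieceLegs L trips)) (ℓ : ℕ) :
    (walksU es ℓ).length ≤ (pieces (pieceLegs L trips)).length * L ^ ℓ :=
  (length_walksU_le es (fun P => (length_nbrs_le_of_sublist h P).trans (length_nbrs_pieceLegs_le hL trips P)) ℓ).trans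
    (Nat.mul_le_mul_right _ (length_pieces_le_of_sublist h))

/-- **Alternating-sequence counts on a sublist of the pieced legs**: `≤ 3m · L^t`. -/
theorem length_aseqsU_sub_le {L : ℕ} (hL : 0 < L) (trips : List (ℕ × ℕ × ℕ)) {es : List PLeg}
    (h : List.Sublist es (pieceLegs L trips)) (t : ℕ) :
    (aseqsU es t).length ≤ 3 * trips.length * L ^ t :=
  (length_aseqsU_le es (fun P => (length_filter_lab_le hL trips h P).1) (fun P => (length_filter_lab_le hL trips h P).2) t).trans
    (Nat.mul_le_mul_right _ (by rw [← length_pieceLegs L trips]; exact h.length_le))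

/-! ## Cards -/

/-- `|V₁ s| = #left pieces of the legs of spot s` (the machine's `lpieces`). -/
theorem card_V₁M_eq_length_lpieces (L : ℕ) (I : LocalMap 3 n m) {labels : List ℕ} {r : ℕ} (hlab : ∀ lab ∈ labels, lab ≤ r)
    (hlen : labels.length = 3 * m) (s : Fin r) :
    (V₁M L I labels r hlab s).card = (lpieces (slegs (pieceLegs L (trips I)) labels s.val)).length := by
  classical
  unfold lpieces
  rw [← List.card_toFinset, ← Finset.card_image_of_injective (V₁M L I labels r hlab s) Subtype.val_injective]
  congr 1
  ext P
  simp only [V₁M, Finset.mem_image, Finset.mem_filter, Finset.mem_univ, true_and, List.mem_toFinset, List.mem_map]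
  constructor
  · rintro ⟨a, ⟨e, he, rfl⟩, rfl⟩
    exact ⟨plegOf L I e, (mem_slegs_iff_pM L I hlab hlen s _).2 ⟨e, he, rfl⟩, rfl⟩
  · rintro ⟨x, hx, rfl⟩
    obtain ⟨e, he, rfl⟩ := (mem_slegs_iff_pM L I hlab hlen s x).1 hx
    exact ⟨srcM L I e, ⟨e, he, rfl⟩, rfl⟩

/-- `|V₂ s| = #right pieces of the legs of spot s`. -/
theorem card_V₂M_eq_length_rpieces (L : ℕ) (I : LocalMap 3 n m) {labels : List ℕ} {r : ℕ} (hlab : ∀ lab ∈ labels, lab ≤ r)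
    (hlen : labels.length = 3 * m) (s : Fin r) :
    (V₂M L I labels r hlab s).card = (rpieces (slegs (pieceLegs L (trips I)) labels s.val)).length := by
  classical
  unfold rpieces
  rw [← List.card_toFinset, ← Finset.card_image_of_injective (V₂M L I labels r hlab s) Subtype.val_injective]
  congr 1
  ext P
  simp only [V₂M, Finset.mem_image, Finset.mem_filter, Finset.mem_univ, true_and, List.mem_toFinset, List.mem_map]
  constructor
  · rintro ⟨a, ⟨e, he, rfl⟩, rfl⟩
    exact ⟨plegOf L I e, (mem_slegs_iff_pM L I hlab hlen s _).2 ⟨e, he, rfl⟩, rfl⟩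
  · rintro ⟨x, hx, rfl⟩
    obtain ⟨e, he, rfl⟩ := (mem_slegs_iff_pM L I hlab hlen s x).1 hx
    exact ⟨dstM L I e, ⟨e, he, rfl⟩, rfl⟩

/-- **The machine's `N = #pieces` is `|LPiece| + |RPiece|`.** -/
theorem length_pieces_eq_card (L : ℕ) (I : LocalMap 3 n m) :
    (pieces (pieceLegs L (trips I))).length = Fintype.card (LPiece L I) + Fintype.card (RPiece L I) := by
  classical
  rw [Fintype.card_of_subtype ((pieceLegs L (trips I)).map labL).toFinset (fun P => List.mem_toFinset),
    Fintype.card_of_subtype ((pieceLegs L (trips I)).map labR).toFinset (fun P => List.mem_toFinset)]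
  unfold pieces
  rw [← List.card_toFinset, List.toFinset_append, Finset.card_union_of_disjoint]
  rw [Finset.disjoint_left]
  intro P h1 h2
  rw [List.mem_toFinset, List.mem_map] at h1 h2
  obtain ⟨x, _, rfl⟩ := h1
  obtain ⟨y, _, h⟩ := h2
  exact labL_ne_labR x y h.symm

/-! ## Parameters for `N ≥ 1` -/

/-- `j + 1 ≥ 1`, i.e. `(j+1) − 1 + 1 = j + 1` for the machine's `j + 1 = prmJ1 N`. -/
theorem prmJ1_sub_add {N : ℕ} (hN : 1 ≤ N) : prmJ1 N - 1 + 1 = prmJ1 N := SfmBl.sfmBl_params_j_ok hN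

/-- `t₀` in the shape of `sfmBl_params_spec` (with `j := prmJ1 N − 1`). -/
theorem prmT0_eq' {N : ℕ} (hN : 1 ≤ N) : prmT0 N = (2 * 2 ^ (prmJ1 N - 1 + 1) + 2 * prmB N) / 10 := by
  rw [prmJ1_sub_add hN]; rfl

/-- THE MAGNITUDE BOUNDS of p3's `sfmBl_params_bounds` for the machine's parameters. -/
theorem params_bounds {N : ℕ} (hN : 1 ≤ N) :
    2 ^ prmJ1 N ≤ 40 * N ∧ prmT0 N ≤ 40 * N ∧ (2 ^ 60) ^ (2 * 2 ^ prmJ1 N) ≤ (40 * N) ^ 240 ∧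
      (2 ^ 60) ^ (2 * prmT0 N) ≤ (40 * N) ^ 120 ∧ 2 ^ prmT0 N ≤ 40 * N := by
  obtain ⟨h1, -, h3, h4, h5, h6, h7⟩ :=
    SfmBl.sfmBl_params_bounds hN (b := prmB N) (j := prmJ1 N - 1) (t₀ := prmT0 N) rfl (prmJ1_sub_add hN) (prmT0_eq' hN)
  rw [prmJ1_sub_add hN] at h1
  have e2 : 2 ^ (prmJ1 N - 1 + 2) = 2 * 2 ^ prmJ1 N := by
    rw [show prmJ1 N - 1 + 2 = prmJ1 N + 1 by have := prmJ1_sub_add hN; omega, pow_succ, mul_comm]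
  rw [e2] at h5
  have hs : Nat.size (20 * N) ≤ 20 * N := Nat.size_le.2 Nat.lt_two_pow_self
  have hs' : Nat.size (20 * N) < 2 ^ Nat.size (20 * N) := Nat.lt_two_pow_self
  refine ⟨by omega, by omega, h5, (Nat.pow_le_pow_right (by norm_num) (by omega)).trans h6,
    (Nat.pow_le_pow_right (by norm_num) (Nat.le_succ _)).trans h7⟩

/-- The clamp on `t₀` is inactive. -/
theorem prmT0'_eq {N : ℕ} (hN : 1 ≤ N) : prmT0' N = prmT0 N := min_eq_left (params_bounds hN).2.1

/-- The clamp on `q + 1 = 2^(j+1)` is inactive. -/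
theorem prmQ1'_eq {N : ℕ} (hN : 1 ≤ N) : prmQ1' N = 2 ^ prmJ1 N := min_eq_left (params_bounds hN).1

end Summit.PneNP.PneNP.Theorems.SfmBlMachine
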